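import Summits.BirchSwinnertonDyer.BirchSwinnertonDyer.Theorems.ByReductionTypeAtTwoAdditiveKatoEulerSystemClassNeZeroAtTwo
import HarnessLib

/-!
# Route `ByReductionTypeAtTwo` (rung K4), crux `SupersingularRankZeroAtTwo` (item stmt-BirchSwinnertonDyer-19097), line
# `odd_blind_package` v2.16 (894e1c85…), stub 3/6 `stub_flatPackage`, conjunct (8) — **ITS LAST SUB-CLAUSE (ZL2), THE ZETA LINE IN
# LOCAL FORM, over DISPLAYED witnesses `(I, Z := Λ ∙ z, z)`** (cell `bsd-2adic`, seat `bsd-2adic-tower-1` GEN 67, hand H2-F1F3 (D4);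
# `--supports 19097`, helper)

HONEST FRAMING (D-0054): THEOREMS ONLY — no definition, no named fact, no instance, no `sorry`.  The registered conjunct (8) of
`FlatPackageAtTwo` (:1640–1659 of the registered bytes) ends with the ZETA LINE IN LOCAL FORM

  (ZL2) `∃ s₀ : I.H, Z = Λ ∙ s₀ ∧ ∀ 𝔭 (ht 𝔭 = 1), C 2 ∉ 𝔭 → ∃ M s, M ∉ 𝔭 ∧ IsEulerSystemClassTwo W hκ I s ∧ s ≠ 0 ∧ M • s₀ = s`

for the ∃-bound `Z ⊆ I.H = 𝐇¹_Γ(T₂W)`.  This file discharges it for the witness the hand's displayed-witness contract names —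
`Z := Λ ∙ z` for a NON-ZERO GENUINE `2`-adic Euler-system class `z` (`s₀ := z`, `M := 1`, `s := z`; `1 ∉ 𝔭` because a prime
ideal is proper) — in three forms: (i) `zetaLineLocal_of_isEulerSystemClassTwo` over displayed `(I, Z, z)`; (ii)
`zetaLineLocal_of_zetaBody` for THE Λ-adic lift `y` of a Kato `ZetaBody` family with admissible `(c, d, a, A)` (the class about which
F3 will be proved — `Kato2004.isEulerSystemClassTwo_of_zetaBody` + `zetaBody_lift_ne_zero_of_rohrlich_two`, Rohrlich fed from the
KERNEL theorem `PSRohrlichAtLevel.rohrlich_primePow_of_isNewformOf`); (iii) `exists_zetaLineLocal_two` on the habitat (`W[2]`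
irreducible, `κ` cyclotomic, any pin `I`) modulo the ONE construction fact `Kato2004.exists_eulerSystem_expStar_values` (hES), via
`AddKatoTwo.exists_isEulerSystemClassTwo_ne_zero`.  What is NOT here: that the F3-pinned `s₀` (with `Col♭(loc s₀) ∣ ϖ·L♭`) is such a
`z` — that is the zeta-element PROVENANCE and travels with F3 (Kato §13.9–13.14 at `2`).  Closes NO stub by itself; 19097 OPEN;
nothing booked; BSD is proved for no curve; typed ≠ proved.

References: [Kato2004Asterisque] K. Kato, Astérisque 295 (2004), §13.1 (13.1.1), Ex. 13.3 (p. 225), Thm. 13.4 (p. 226), §13.9–13.14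
(pp. 229–234); [RohrlichInventiones1984] D. Rohrlich, Invent. Math. 75 (1984), Theorem (p. 409); [Sprung2012] §7 (the objects served).
-/

set_option autoImplicit false
-- the Theorems namespace of this sub repeats the summit name by design (D-0017 nested layout)
set_option linter.dupNamespace false

noncomputable section

open scoped NumberField TensorProduct

namespace Summit.BirchSwinnertonDyer.BirchSwinnertonDyer.Theorems

namespace SSFlatPackage

open Field CongruenceSubgroup WeierstrassCurve NumberField IsDedekindDomain
  Literature.NumberTheory.GaloisRepresentations
  Literature.NumberTheory.EllipticCurves Literature.NumberTheory.EllipticCurves.ModularForms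
  Literature.NumberTheory.EllipticCurves.Kato2004 Literature.NumberTheory.EllipticCurves.Kato2004.EulerSystemValues

variable (W : WeierstrassCurve ℚ) [W.IsElliptic] [ContinuousSMul ℤ_[2] (W.tateModule 2)]
  [Module.Free ℤ_[2] (W.tateModule 2)] [Module.Finite ℤ_[2] (W.tateModule 2)]
  {κ : ZpExtension ℚ 2} (hκ : κ.IsCyclotomic) {γ : absoluteGaloisGroup ℚ} (I : IwasawaH1Data W 2 κ γ)

/-- **(ZL2) over displayed witnesses.**  For any pin `I = 𝐇¹_Γ(T₂W)`, any NON-ZERO GENUINE `2`-adic Euler-system class `z ∈ I.H`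
and `Z = Λ ∙ z`: the zeta line in local form holds with `s₀ := z` — at every height-one `𝔭 ∌ 2` take `M := 1 ∉ 𝔭` (a prime ideal is
proper) and `s := z`.  The last sub-clause of conjunct (8) of `FlatPackageAtTwo`, VERBATIM in shape.
[cite: Kato2004Asterisque, Thm. 13.4 (p. 226) and §13.9–13.14 (pp. 229–234)] -/
theorem zetaLineLocal_of_isEulerSystemClassTwo {z : I.H} (hz : IsEulerSystemClassTwo W hκ I z) (hz0 : z ≠ 0)
    {Z : Submodule (IwasawaAlgebra 2) I.H} (hZ : Z = Submodule.span (IwasawaAlgebra 2) {z}) :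
    ∃ s₀ : I.H, Z = Submodule.span (IwasawaAlgebra 2) {s₀} ∧
      ∀ 𝔭 : PrimeSpectrum (IwasawaAlgebra 2), 𝔭.asIdeal.height = 1 →
        PowerSeries.C (2 : ℤ_[2]) ∉ 𝔭.asIdeal →
        ∃ (M : IwasawaAlgebra 2) (s : I.H), M ∉ 𝔭.asIdeal ∧
          IsEulerSystemClassTwo W hκ I s ∧ s ≠ 0 ∧ M • s₀ = s :=
  ⟨z, hZ, fun 𝔭 _ _ ↦ ⟨1, z, (Ideal.ne_top_iff_one _).mp 𝔭.isPrime.ne_top, hz, hz0, one_smul _ _⟩⟩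

/-- **(ZL2) for THE zeta class.**  For a Kato zeta family `(κ_K, Λ_K, z, x)` of `T₂W` with its values (`ZetaBody W 2 f ι κ_K Λ_K c d a A z x`,
`f` a newform of `W`, `κ_K ≠ 0`) at an ADMISSIBLE datum `(c, d, a, A)` (Kato Ex. 13.3 / 13.9: `A ≥ 1`, `(c, 12A) = (d, 12N) = 1`,
`c ≡ d ≡ 1 (mod A)`, `c, d > 1`, `[a/A]⁻_f ≠ 0`), and `y ∈ 𝐇¹_Γ(T₂W)` ITS Λ-adic lift (`proj_n y = Cor_{ℚ(μ_{2^{n+2}})/ℚ_n} z_{2^{n+2}}`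
for all `n`): (ZL2) holds for `Z := Λ ∙ y` with `s₀ := y`.  Genuineness is `Kato2004.isEulerSystemClassTwo_of_zetaBody`; `y ≠ 0` is
`Kato2004.zetaBody_lift_ne_zero_of_rohrlich_two` with Rohrlich's finiteness at `2` supplied by the KERNEL theorem
`PSRohrlichAtLevel.rohrlich_primePow_of_isNewformOf` (any level, `2 ∣ N` allowed).  This is the form F3 consumes (same `y`).
[cite: Kato2004Asterisque, Ex. 13.3 (p. 225), 13.9 (p. 229), Thm. 12.5 (1) (pp. 221–222), Thm. 13.4 (p. 226)]
[cite: RohrlichInventiones1984, Theorem (p. 409)] -/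
theorem zetaLineLocal_of_zetaBody {N : ℕ} [NeZero N] {f : CuspForm (Gamma0 N) 2} (hf : IsNewformOf W f)
    {ι : (m : ℕ) → (CyclotomicField m ℚ →+* ℂ)} {κ' : ℝ} (hκ' : κ' ≠ 0)
    {Λ' : ∀ (k : ℕ) (r : Finset (HeightOneSpectrum (𝓞 ℚ))),
      H1 (tateRep W 2) (cycSubgroup 2 k r) →ₗ[ℤ_[2]] ℚ_[2] ⊗[ℚ] CyclotomicField (cycLevel 2 k r) ℚ}
    {c d a : ℤ} {A : ℕ}
    {z : ∀ (k : ℕ) (r : (cyclotomicLevelsRat 2 (badPlaces c d A N)).Ideals),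
      H1 (tateRep W 2) ((cyclotomicLevelsRat 2 (badPlaces c d A N)).level k r.1)}
    {x : ∀ (k : ℕ) (r : (cyclotomicLevelsRat 2 (badPlaces c d A N)).Ideals), CyclotomicField (cycLevel 2 k r.1) ℚ}
    (hbody : ZetaBody W 2 f ι κ' Λ' c d a A z x)
    (hA : 0 < A) (hc : Int.gcd c (6 * 2 * A) = 1) (hd : Int.gcd d (6 * 2 * N) = 1) (hcA : (A : ℤ) ∣ c - 1)
    (hdA : (A : ℤ) ∣ d - 1) (hc1 : 1 < c) (hd1 : 1 < d) (ha : ratMinusSymbol f ((a : ℚ) / A) ≠ 0)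
    {y : I.H}
    (hy : ∀ n : ℕ, I.proj n y = levelToLayerTwo W hκ (badPlaces c d A N) n
      (z (n + 2) (cyclotomicLevelsRat 2 (badPlaces c d A N)).idealOne)) :
    ∃ s₀ : I.H, Submodule.span (IwasawaAlgebra 2) {y} = Submodule.span (IwasawaAlgebra 2) {s₀} ∧
      ∀ 𝔭 : PrimeSpectrum (IwasawaAlgebra 2), 𝔭.asIdeal.height = 1 →
        PowerSeries.C (2 : ℤ_[2]) ∉ 𝔭.asIdeal →
        ∃ (M : IwasawaAlgebra 2) (s : I.H), M ∉ 𝔭.asIdeal ∧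
          IsEulerSystemClassTwo W hκ I s ∧ s ≠ 0 ∧ M • s₀ = s := by
  have hne : 2 * c.natAbs * d.natAbs * A * N ≠ 0 := two_mul_natAbs_ne_zero_of_guards 2 hA (NeZero.ne N) hc hd
  exact zetaLineLocal_of_isEulerSystemClassTwo W hκ I (isEulerSystemClassTwo_of_zetaBody W hκ I hbody hne hy)
    (zetaBody_lift_ne_zero_of_rohrlich_two hbody hf hκ' hA hc hd hcA hdA hc1 hd1 ha hκ hy
      (PSRohrlichAtLevel.rohrlich_primePow_of_isNewformOf (p := 2) hf)) rfl

/-- **(ZL2) on the habitat, modulo the one construction fact.**  For `W/ℚ` elliptic with `W[2]` irreducible (⟸ good supersingular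
at `2`), a newform `f` of `W`, `κ` the cyclotomic `ℤ₂`-extension and ANY pin `I`: GRANTED `Kato2004.exists_eulerSystem_expStar_values`
(hES) there is `z ∈ 𝐇¹_Γ(T₂W)`, a non-zero genuine `2`-adic Euler-system class (`AddKatoTwo.exists_isEulerSystemClassTwo_ne_zero`,
Rohrlich from the kernel), for which (ZL2) holds with `Z := Λ ∙ z`.  CONDITIONAL on hES.
[cite: Kato2004Asterisque, Thm. 12.5 (1) (pp. 221–222), Ex. 13.3 (p. 225), Thm. 13.4 (p. 226)] [cite: RohrlichInventiones1984, Theorem (p. 409)] -/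
theorem exists_zetaLineLocal_two (hES : exists_eulerSystem_expStar_values) (hirr : W.HasIrreducibleModPGaloisRep 2)
    {N : ℕ} [NeZero N] (f : CuspForm (Gamma0 N) 2) (hf : IsNewformOf W f) :
    ∃ z : I.H, IsEulerSystemClassTwo W hκ I z ∧ z ≠ 0 ∧
      ∃ s₀ : I.H, Submodule.span (IwasawaAlgebra 2) {z} = Submodule.span (IwasawaAlgebra 2) {s₀} ∧
        ∀ 𝔭 : PrimeSpectrum (IwasawaAlgebra 2), 𝔭.asIdeal.height = 1 →
          PowerSeries.C (2 : ℤ_[2]) ∉ 𝔭.asIdeal →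
          ∃ (M : IwasawaAlgebra 2) (s : I.H), M ∉ 𝔭.asIdeal ∧
            IsEulerSystemClassTwo W hκ I s ∧ s ≠ 0 ∧ M • s₀ = s := by
  obtain ⟨z, hz, hz0⟩ := AddKatoTwo.exists_isEulerSystemClassTwo_ne_zero W I hκ hES hirr f hf
  exact ⟨z, hz, hz0, zetaLineLocal_of_isEulerSystemClassTwo W hκ I hz hz0 rfl⟩

end SSFlatPackage

end Summit.BirchSwinnertonDyer.BirchSwinnertonDyer.Theorems

end
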